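import Summits.QuantumFields.BalabanUV.Beta.EriceRemainderEnclosureHistoryAutonomyOrder

/-!
# EriceRemainderEnclosureHistoryAutonomyOrderLag — (E48f) THE SCALE LAG OF TWO TRAJECTORIES IS A RENORMALIZATION-GROUP INVARIANT: in every uniqueness regime
# of the flow with memory (zeroth moment `M` of ANY size, floor `b > 0` on ]0,γ]) two box solutions `h, h′` from pins `t < t′` INTERLACE — if the larger one passes
# below `t` after `N` steps (`h′_N ≤ t < h′_{N−1}`), then `h′_{j+N} ≤ h_j < h′_j` and `h_j < h′_{j+N−1}` at EVERY scale `j` — so the recursion-variable offset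
# `δ_j = 1∕h_j² − 1∕h′_j²` is squeezed between `N−1` and `N` one-step increments of the larger trajectory: `(N−1)·b ≤ δ_j ≤ N·(B(γ,…) + M·γ)` UNIFORMLY IN THE SCALE,
# for ANY `M` ((E43a)'s one-pin bound `10M³∕(b³√b)` needed three bootstrap rounds; order gives the two-pin bound in one line), and `|h_j − h′_j| ≤ (1∕γ² + j·b)^{−3∕2}∕2·N·U → 0`

Cell `pub-balaban`, β-function sub-cell, BINDER row D4 «RemainderConst leaves for Bałaban's split» (`HOME/BINDER-OWNERS.md`; owner lineage `b2b-balaban-beta-an4`;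
this file by co-owner #2 lineage `b2b-balaban-beta-d4-p2`, generation 45), β-FLOW TEAM duty (1), FREEZE (0) honoured (def-free; node U2's `MemFlow` ∕ `SeqBox` ∕
`Sharpness.abs_sub_le_half_cube_mul`, (E37b)'s `le_upper_zm`, (E40)'s `le_envelope_of_memFlow` ∕ `invSqrt_tail_le`, (E48a)'s `le_of_pin_le` ∕ `lt_of_pin_lt` ∕ `memFlow_tail`
BY NAME; the lag `N` is a hypothesis `h′ N ≤ t ∧ t < h′ (N−1)`, located by `exists_lag`, never a `def`).  Sequel of (E48a) `…HistoryAutonomyOrder` (imported).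

HONEST FRAMING (page 1, verbatim and binding).  *"Discharging BetaPertH makes Bałaban's UV stability UNCONDITIONAL — a real constructive-QFT result; it is
NOT the continuum limit and NOT the Clay problem."*  THIS FILE DISCHARGES NOTHING OF THE KIND.  Pure real analysis about an ABSTRACT functional with displayed
zeroth moment and floor, in a displayed uniqueness regime — hypotheses, not facts; nothing of Bałaban's (1.22) asserted (GAPS G-t4-U2-1∕-2).  Row D4 class
UNCHANGED (critical-path width 0; instance 0∕1; D4 DISCHARGE NO DATE).  HONEST DEPENDENCY: continuum YM on T⁴ ⇐ BetaPertH ∧ nine spine estimates (0/9 proved);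
BetaPertH ⇐ (D1) ∧ (D4) ∧ CAP+tail; G-an2-4 gates asym, D1 and NE2/3/4.

THE POINT (census sense (α); the AUTONOMY row — the offset of two ordered trajectories).  (E48a): in a uniqueness regime the solution family is ordered and
generated by one increasing one-step map `f`, `h_j = f^[j](t)`.  Hence the SHIFTED larger trajectory `h′(N+·) = S(h′_N)` is itself comparable with `h = S(t)`:
`h′_N ≤ t` gives `h′_{j+N} ≤ h_j` and `t < h′_{N−1}` gives `h_j < h′_{j+N−1}`, at EVERY `j` (§2 `interlace_le`, `interlace_lt`) — the integer LAG between two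
trajectories of one flow is the same at all scales (an RG invariant), the discrete shadow of the «Λ-parameter».  Reading the offset through the larger
trajectory's own increments `1∕h′_{j+k}² − 1∕h′_j² = Σ_{i<k} B(h′(j+i+1+·)) ∈ [k·b, k·U]` (§1 `increments_between`): `(N−1)·b ≤ δ_j ≤ N·U` with `U = B(γ,…) + M·γ`
(§3 **`disc_le_of_lag`**, **`le_disc_of_lag`**, **`disc_bounds_of_lag`**) — a two-sided bound UNIFORM IN THE SCALE and valid for EVERY size of `M` in any uniqueness
regime (closed threshold; isotone memory), where (E43a) needed `10M³∕(b³√b)` and three bootstrap rounds for one pin and (E48c) needed the SIGN of the memory;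
and since both couplings sit under the envelope `(1∕γ² + j·b)^{−1∕2}`, `|h_j − h′_j| ≤ (1∕γ² + j·b)^{−3∕2}∕2·N·U` (§3 **`abs_sub_le_of_lag`**): the trajectories MERGE
in `g` at the rate `j^{−3∕2}` while their `1∕g²`-offset stays of order `N` (**`tendsto_sub_zero`**).  §1 also locates the lag: every box solution passes below any
level `t > 0` (`exists_le_level`, `exists_lag`).  NOT claimed: convergence of `δ_j` for general memory (isotone: (E48c); general: open here); anything printed.

WHAT IS PROVED ([folklore]; 0 `def`, 0 sorry).  §1 `increments_between` (`k·b ≤ 1∕h_{j+k}² − 1∕h_j² ≤ k·U`), `exists_le_level`, **`exists_lag`** (`∃ N ≥ 1, h′ N ≤ t < h′ (N−1)`).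
§2 **`interlace_le`** (`h′_N ≤ t ⟹ h′_{j+N} ≤ h_j`), **`interlace_lt`** (`t < h′_k ⟹ h_j < h′_{j+k}`).  §3 **`disc_le_of_lag`**, **`le_disc_of_lag`**, **`disc_bounds_of_lag`**,
**`abs_sub_le_of_lag`**, **`tendsto_sub_zero`**, `disc_bounds_zs_closed`.
-/

noncomputable section
open Filter Topology Finset Set

namespace Summit.QuantumFields.BalabanUV.Beta.EriceRemainderEnclosureHistoryAutonomyOrderLag

open Literature.MathematicalPhysics.QuantumFieldTheory.Balaban1983to89
open Literature.MathematicalPhysics.QuantumFieldTheory.Balaban1983to89.T4BetaStationary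
open Literature.MathematicalPhysics.QuantumFieldTheory.Balaban1983to89.T4BetaFlowWellPosed
open Literature.MathematicalPhysics.QuantumFieldTheory.Balaban1983to89.T4BetaFlowWellPosed.Sharpness (abs_sub_le_half_cube_mul)
open Summit.QuantumFields.BalabanUV.Beta.EriceRemainderEnclosureHistoryAutonomyThreshold (memFlow_unique_zs_closed)
open Summit.QuantumFields.BalabanUV.Beta.EriceRemainderEnclosureHistoryAutonomyContinuity (le_envelope_of_memFlow invSqrt_tail_le)
open Summit.QuantumFields.BalabanUV.Beta.EriceRemainderEnclosureHistoryAutonomyOrder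

variable {B : (ℕ → ℝ) → ℝ} {M γ b U t t' : ℝ} {h h' : ℕ → ℝ}

/-! ## §1 Increments of one trajectory between two scales; every trajectory passes below every level -/

/-- `k` STEPS OF ONE TRAJECTORY: `k·b ≤ 1∕h_{j+k}² − 1∕h_j² ≤ k·U` for a box solution of a flow with `b ≤ B ≤ U` on the box. [folklore] -/
theorem increments_between (hlo : ∀ u, SeqBox γ u → b ≤ B u) (hU : ∀ u, SeqBox γ u → B u ≤ U) (hh : SeqBox γ h) {gIR : ℝ}
    (hf : MemFlow B gIR h) (j : ℕ) : ∀ k : ℕ,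
    (k : ℝ) * b ≤ 1 / h (j + k) ^ 2 - 1 / h j ^ 2 ∧ 1 / h (j + k) ^ 2 - 1 / h j ^ 2 ≤ (k : ℝ) * U
  | 0 => by simp
  | k + 1 => by
      have ih := increments_between hlo hU hh hf j k
      have hstep := hf.2 (j + k)
      have hB1 := hlo _ (seqBox_shift hh (j + k + 1))
      have hB2 := hU _ (seqBox_shift hh (j + k + 1))
      rw [show j + (k + 1) = j + k + 1 by omega, hstep]
      push_cast
      constructor <;> nlinarith [ih.1, ih.2]

/-- EVERY BOX SOLUTION PASSES BELOW EVERY POSITIVE LEVEL: `∃ k, h k ≤ s` (the envelope `(1∕γ² + k·b)^{−1∕2} → 0`). [folklore] -/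
theorem exists_le_level (hb : 0 < b) (hlo : ∀ u, SeqBox γ u → b ≤ B u) {gIR : ℝ} (hgIR : 0 < gIR) (hgIRγ : gIR ≤ γ)
    (hh : SeqBox γ h) (hf : MemFlow B gIR h) {s : ℝ} (hs : 0 < s) : ∃ k : ℕ, h k ≤ s := by
  obtain ⟨J, hJ⟩ := invSqrt_tail_le (γ := γ) hb hs
  exact ⟨J, (le_envelope_of_memFlow hb hgIR hgIRγ hlo hh hf J).trans (hJ J le_rfl)⟩

/-- **THE LAG**: for a box solution `h′` from `t′ > t > 0` there is `N ≥ 1` with `h′ N ≤ t < h′ (N − 1)` — the first scale at which the larger trajectory is at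
or below the smaller pin. [folklore] -/
theorem exists_lag (hb : 0 < b) (hlo : ∀ u, SeqBox γ u → b ≤ B u) (ht : 0 < t) (htt' : t < t') (ht'γ : t' ≤ γ)
    (hh' : SeqBox γ h') (hf' : MemFlow B t' h') : ∃ N : ℕ, 1 ≤ N ∧ h' N ≤ t ∧ t < h' (N - 1) := by
  classical
  have hex : ∃ k : ℕ, h' k ≤ t := exists_le_level hb hlo (ht.trans htt') ht'γ hh' hf' ht
  refine ⟨Nat.find hex, ?_, Nat.find_spec hex, ?_⟩
  · by_contra h0
    have h00 : Nat.find hex = 0 := by omega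
    have := Nat.find_spec hex
    rw [h00, hf'.1] at this
    exact absurd this (not_le.2 htt')
  · have hN0 : 0 < Nat.find hex := by
      by_contra h0
      have h00 : Nat.find hex = 0 := by omega
      have := Nat.find_spec hex
      rw [h00, hf'.1] at this
      exact absurd this (not_le.2 htt')
    have := Nat.find_min hex (m := Nat.find hex - 1) (by omega)
    exact not_le.1 this

/-! ## §2 Interlacing: the shifted larger trajectory is comparable with the smaller one at every scale -/

/-- **INTERLACING FROM ABOVE**: in a uniqueness regime, `h′ k ≤ t` ⟹ `h′ (j + k) ≤ h j` for every `j` — the tail `h′(k+·)` is THE solution from `h′ k ≤ t`, and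
the solution is weakly increasing in the pin ((E48a) `le_of_pin_le`). [folklore] -/
theorem interlace_le (hb : 0 < b)
    (hB : ∀ u u' : ℕ → ℝ, SeqBox γ u → SeqBox γ u' → ∀ D : ℝ, (∀ j, |u j - u' j| ≤ D) → |B u - B u'| ≤ M * D)
    (hM : 0 ≤ M) (hlo : ∀ u, SeqBox γ u → b ≤ B u)
    (huniq : ∀ p, 0 < p → p ≤ γ → ∀ u u' : ℕ → ℝ, SeqBox γ u → SeqBox γ u' → MemFlow B p u → MemFlow B p u' → u = u')
    (htγ : t ≤ γ) (hh : SeqBox γ h) (hh' : SeqBox γ h') (hf : MemFlow B t h) (hf' : MemFlow B t' h')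
    {k : ℕ} (hk : h' k ≤ t) (j : ℕ) : h' (j + k) ≤ h j := by
  have := le_of_pin_le hb hB hM hlo huniq (hh' k).1 hk htγ (seqBox_shift hh' k) hh (memFlow_tail hf' k) hf j
  simpa [add_comm] using this

/-- **INTERLACING FROM BELOW**: in a uniqueness regime, `t < h′ k` ⟹ `h j < h′ (j + k)` for every `j` ((E48a) `lt_of_pin_lt`). [folklore] -/
theorem interlace_lt (hb : 0 < b)
    (hB : ∀ u u' : ℕ → ℝ, SeqBox γ u → SeqBox γ u' → ∀ D : ℝ, (∀ j, |u j - u' j| ≤ D) → |B u - B u'| ≤ M * D)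
    (hM : 0 ≤ M) (hlo : ∀ u, SeqBox γ u → b ≤ B u)
    (huniq : ∀ p, 0 < p → p ≤ γ → ∀ u u' : ℕ → ℝ, SeqBox γ u → SeqBox γ u' → MemFlow B p u → MemFlow B p u' → u = u')
    (ht : 0 < t) (hh : SeqBox γ h) (hh' : SeqBox γ h') (hf : MemFlow B t h) (hf' : MemFlow B t' h')
    {k : ℕ} (hk : t < h' k) (j : ℕ) : h j < h' (j + k) := by
  have := lt_of_pin_lt hb hB hM hlo huniq ht hk (hh' k).2 hh (seqBox_shift hh' k) hf (memFlow_tail hf' k) j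
  simpa [add_comm] using this

/-! ## §3 The offset of two trajectories is squeezed between `N − 1` and `N` increments of the larger one — uniformly in the scale, for any `M` -/

/-- **UPPER BOUND ON THE OFFSET**: `h′ N ≤ t` ⟹ `1∕h_j² − 1∕h′_j² ≤ 1∕h′_{j+N}² − 1∕h′_j² ≤ N·U` at every scale. [folklore] -/
theorem disc_le_of_lag (hb : 0 < b)
    (hB : ∀ u u' : ℕ → ℝ, SeqBox γ u → SeqBox γ u' → ∀ D : ℝ, (∀ j, |u j - u' j| ≤ D) → |B u - B u'| ≤ M * D)
    (hM : 0 ≤ M) (hlo : ∀ u, SeqBox γ u → b ≤ B u) (hU : ∀ u, SeqBox γ u → B u ≤ U)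
    (huniq : ∀ p, 0 < p → p ≤ γ → ∀ u u' : ℕ → ℝ, SeqBox γ u → SeqBox γ u' → MemFlow B p u → MemFlow B p u' → u = u')
    (htγ : t ≤ γ) (hh : SeqBox γ h) (hh' : SeqBox γ h') (hf : MemFlow B t h) (hf' : MemFlow B t' h')
    {N : ℕ} (hN : h' N ≤ t) (j : ℕ) : 1 / h j ^ 2 - 1 / h' j ^ 2 ≤ (N : ℝ) * U := by
  have hle := interlace_le hb hB hM hlo huniq htγ hh hh' hf hf' hN j
  have h1 : 1 / h j ^ 2 ≤ 1 / h' (j + N) ^ 2 :=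
    one_div_le_one_div_of_le (pow_pos (hh' _).1 2) (pow_le_pow_left₀ (hh' _).1.le hle 2)
  linarith [(increments_between hlo hU hh' hf' j N).2]

/-- **LOWER BOUND ON THE OFFSET**: `t < h′ k` ⟹ `k·b ≤ 1∕h′_{j+k}² − 1∕h′_j² < 1∕h_j² − 1∕h′_j²` at every scale. [folklore] -/
theorem le_disc_of_lag (hb : 0 < b)
    (hB : ∀ u u' : ℕ → ℝ, SeqBox γ u → SeqBox γ u' → ∀ D : ℝ, (∀ j, |u j - u' j| ≤ D) → |B u - B u'| ≤ M * D)
    (hM : 0 ≤ M) (hlo : ∀ u, SeqBox γ u → b ≤ B u) (hU : ∀ u, SeqBox γ u → B u ≤ U)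
    (huniq : ∀ p, 0 < p → p ≤ γ → ∀ u u' : ℕ → ℝ, SeqBox γ u → SeqBox γ u' → MemFlow B p u → MemFlow B p u' → u = u')
    (ht : 0 < t) (hh : SeqBox γ h) (hh' : SeqBox γ h') (hf : MemFlow B t h) (hf' : MemFlow B t' h')
    {k : ℕ} (hk : t < h' k) (j : ℕ) : (k : ℝ) * b < 1 / h j ^ 2 - 1 / h' j ^ 2 := by
  have hlt := interlace_lt hb hB hM hlo huniq ht hh hh' hf hf' hk j
  have h1 : 1 / h' (j + k) ^ 2 < 1 / h j ^ 2 :=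
    one_div_lt_one_div_of_lt (pow_pos (hh _).1 2) (pow_lt_pow_left₀ hlt (hh _).1.le two_ne_zero)
  linarith [(increments_between hlo hU hh' hf' j k).1]

/-- **THE SCALE LAG IS AN RG INVARIANT**: with the lag `N ≥ 1` of `exists_lag` (`h′ N ≤ t < h′ (N−1)`), at EVERY scale `(N − 1)·b < 1∕h_j² − 1∕h′_j² ≤ N·U` —
a two-sided bound on the `1∕g²`-offset UNIFORM in the scale, for EVERY size of `M`, in any uniqueness regime. [folklore] -/
theorem disc_bounds_of_lag (hb : 0 < b)
    (hB : ∀ u u' : ℕ → ℝ, SeqBox γ u → SeqBox γ u' → ∀ D : ℝ, (∀ j, |u j - u' j| ≤ D) → |B u - B u'| ≤ M * D)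
    (hM : 0 ≤ M) (hlo : ∀ u, SeqBox γ u → b ≤ B u) (hU : ∀ u, SeqBox γ u → B u ≤ U)
    (huniq : ∀ p, 0 < p → p ≤ γ → ∀ u u' : ℕ → ℝ, SeqBox γ u → SeqBox γ u' → MemFlow B p u → MemFlow B p u' → u = u')
    (ht : 0 < t) (htγ : t ≤ γ) (hh : SeqBox γ h) (hh' : SeqBox γ h') (hf : MemFlow B t h) (hf' : MemFlow B t' h')
    {N : ℕ} (hN1 : 1 ≤ N) (hN : h' N ≤ t) (hN' : t < h' (N - 1)) (j : ℕ) :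
    ((N : ℝ) - 1) * b < 1 / h j ^ 2 - 1 / h' j ^ 2 ∧ 1 / h j ^ 2 - 1 / h' j ^ 2 ≤ (N : ℝ) * U := by
  refine ⟨?_, disc_le_of_lag hb hB hM hlo hU huniq htγ hh hh' hf hf' hN j⟩
  have := le_disc_of_lag hb hB hM hlo hU huniq ht hh hh' hf hf' hN' j
  have e : ((N - 1 : ℕ) : ℝ) = (N : ℝ) - 1 := by rw [Nat.cast_sub hN1, Nat.cast_one]
  rwa [e] at this

/-- **THE TRAJECTORIES MERGE IN `g` AT THE RATE `j^{−3∕2}`**: `h′ N ≤ t` ⟹ `|h_j − h′_j| ≤ (1∕γ² + j·b)^{−3∕2}∕2·N·U` — half-cube sensitivity under the common envelope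
times the scale-uniform offset. [folklore] -/
theorem abs_sub_le_of_lag (hb : 0 < b)
    (hB : ∀ u u' : ℕ → ℝ, SeqBox γ u → SeqBox γ u' → ∀ D : ℝ, (∀ j, |u j - u' j| ≤ D) → |B u - B u'| ≤ M * D)
    (hM : 0 ≤ M) (hlo : ∀ u, SeqBox γ u → b ≤ B u) (hU : ∀ u, SeqBox γ u → B u ≤ U)
    (huniq : ∀ p, 0 < p → p ≤ γ → ∀ u u' : ℕ → ℝ, SeqBox γ u → SeqBox γ u' → MemFlow B p u → MemFlow B p u' → u = u')
    (ht : 0 < t) (htt' : t ≤ t') (ht'γ : t' ≤ γ) (hh : SeqBox γ h) (hh' : SeqBox γ h') (hf : MemFlow B t h) (hf' : MemFlow B t' h')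
    {N : ℕ} (hN : h' N ≤ t) (j : ℕ) :
    |h j - h' j| ≤ (1 / Real.sqrt (1 / γ ^ 2 + (j : ℝ) * b)) ^ 3 / 2 * ((N : ℝ) * U) := by
  have htγ : t ≤ γ := htt'.trans ht'γ
  have ht' : 0 < t' := ht.trans_le htt'
  have hord : h j ≤ h' j := le_of_pin_le hb hB hM hlo huniq ht htt' ht'γ hh hh' hf hf' j
  have hδ0 : 0 ≤ 1 / h j ^ 2 - 1 / h' j ^ 2 :=
    sub_nonneg.2 (one_div_le_one_div_of_le (pow_pos (hh j).1 2) (pow_le_pow_left₀ (hh j).1.le hord 2))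
  calc |h j - h' j| ≤ (1 / Real.sqrt (1 / γ ^ 2 + (j : ℝ) * b)) ^ 3 / 2 * |1 / h j ^ 2 - 1 / h' j ^ 2| :=
        abs_sub_le_half_cube_mul (hh j).1 (hh' j).1 (le_envelope_of_memFlow hb ht htγ hlo hh hf j)
          (le_envelope_of_memFlow hb ht' ht'γ hlo hh' hf' j)
    _ ≤ (1 / Real.sqrt (1 / γ ^ 2 + (j : ℝ) * b)) ^ 3 / 2 * ((N : ℝ) * U) := by
        rw [abs_of_nonneg hδ0]
        exact mul_le_mul_of_nonneg_left (disc_le_of_lag hb hB hM hlo hU huniq htγ hh hh' hf hf' hN j) (by positivity)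

/-- **TWO TRAJECTORIES OF A WELL-POSED FLOW MERGE IN THE ULTRAVIOLET**: `h j − h′ j → 0` (while their `1∕g²`-offset stays of order the lag). [folklore] -/
theorem tendsto_sub_zero (hb : 0 < b)
    (hB : ∀ u u' : ℕ → ℝ, SeqBox γ u → SeqBox γ u' → ∀ D : ℝ, (∀ j, |u j - u' j| ≤ D) → |B u - B u'| ≤ M * D)
    (hM : 0 ≤ M) (hlo : ∀ u, SeqBox γ u → b ≤ B u)
    (huniq : ∀ p, 0 < p → p ≤ γ → ∀ u u' : ℕ → ℝ, SeqBox γ u → SeqBox γ u' → MemFlow B p u → MemFlow B p u' → u = u')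
    (ht : 0 < t) (htt' : t ≤ t') (ht'γ : t' ≤ γ) (hh : SeqBox γ h) (hh' : SeqBox γ h') (hf : MemFlow B t h) (hf' : MemFlow B t' h') :
    Tendsto (fun j => h j - h' j) atTop (𝓝 0) := by
  have hγ : 0 < γ := ht.trans_le (htt'.trans ht'γ)
  have ht' : 0 < t' := ht.trans_le htt'
  have hU : ∀ u, SeqBox γ u → B u ≤ B (fun _ => γ) + M * γ := le_upper_of_zm hB hγ
  obtain ⟨N, hN⟩ : ∃ N : ℕ, h' N ≤ t := exists_le_level hb hlo ht' ht'γ hh' hf' ht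
  have hNU : 0 ≤ (N : ℝ) * (B (fun _ => γ) + M * γ) := by
    have := (hlo _ (seqBox_const hγ)).trans (hU _ (seqBox_const hγ))
    exact mul_nonneg (Nat.cast_nonneg N) (by linarith)
  rw [Metric.tendsto_atTop]
  intro ε hε
  have hε' : 0 < ε / ((N : ℝ) * (B (fun _ => γ) + M * γ) + 1) := div_pos hε (by linarith)
  -- envelope tail: make the cube of the envelope small
  obtain ⟨J, hJ⟩ := invSqrt_tail_le (γ := γ) hb (show (0 : ℝ) < 1 from one_pos)
  obtain ⟨J', hJ'⟩ := invSqrt_tail_le (γ := γ) hb hε'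
  refine ⟨max J J', fun j hj => ?_⟩
  rw [Real.dist_eq, sub_zero]
  have hc1 : 1 / Real.sqrt (1 / γ ^ 2 + (j : ℝ) * b) ≤ 1 := hJ j (le_of_max_le_left hj)
  have hc2 : 1 / Real.sqrt (1 / γ ^ 2 + (j : ℝ) * b) ≤ ε / ((N : ℝ) * (B (fun _ => γ) + M * γ) + 1) := hJ' j (le_of_max_le_right hj)
  have hc0 : 0 ≤ 1 / Real.sqrt (1 / γ ^ 2 + (j : ℝ) * b) := by positivity
  have hcube : (1 / Real.sqrt (1 / γ ^ 2 + (j : ℝ) * b)) ^ 3 ≤ 1 / Real.sqrt (1 / γ ^ 2 + (j : ℝ) * b) := by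
    calc (1 / Real.sqrt (1 / γ ^ 2 + (j : ℝ) * b)) ^ 3
        = (1 / Real.sqrt (1 / γ ^ 2 + (j : ℝ) * b)) ^ 2 * (1 / Real.sqrt (1 / γ ^ 2 + (j : ℝ) * b)) := by ring
      _ ≤ 1 ^ 2 * (1 / Real.sqrt (1 / γ ^ 2 + (j : ℝ) * b)) :=
          mul_le_mul_of_nonneg_right (pow_le_pow_left₀ hc0 hc1 2) hc0
      _ = _ := by rw [one_pow, one_mul]
  calc |h j - h' j| ≤ (1 / Real.sqrt (1 / γ ^ 2 + (j : ℝ) * b)) ^ 3 / 2 * ((N : ℝ) * (B (fun _ => γ) + M * γ)) :=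
        abs_sub_le_of_lag hb hB hM hlo hU huniq ht htt' ht'γ hh hh' hf hf' hN j
    _ ≤ (ε / ((N : ℝ) * (B (fun _ => γ) + M * γ) + 1)) / 2 * ((N : ℝ) * (B (fun _ => γ) + M * γ)) :=
        mul_le_mul_of_nonneg_right (div_le_div_of_nonneg_right (hcube.trans hc2) (by norm_num)) hNU
    _ < ε := by
        rw [div_div, div_mul_eq_mul_div, div_lt_iff₀ (by positivity)]
        nlinarith

/-- **THE OFFSET ON THE CLOSED THRESHOLD**: zeroth moment `M`, floor `b`, `M·γ ≤ 3√3·b` ((E38a)'s uniqueness); pins `t < t′` in ]0,γ]: with the lag `N` of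
`exists_lag`, `(N − 1)·b < 1∕h_j² − 1∕h′_j² ≤ N·(B(γ,…) + M·γ)` at every scale. [folklore] -/
theorem disc_bounds_zs_closed (hb : 0 < b)
    (hB : ∀ u u' : ℕ → ℝ, SeqBox γ u → SeqBox γ u' → ∀ D : ℝ, (∀ j, |u j - u' j| ≤ D) → |B u - B u'| ≤ M * D)
    (hM : 0 ≤ M) (hlo : ∀ u, SeqBox γ u → b ≤ B u) (hsmall : M * γ ≤ 3 * Real.sqrt 3 * b)
    (ht : 0 < t) (htt' : t < t') (ht'γ : t' ≤ γ) (hh : SeqBox γ h) (hh' : SeqBox γ h') (hf : MemFlow B t h) (hf' : MemFlow B t' h') :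
    ∃ N : ℕ, 1 ≤ N ∧ h' N ≤ t ∧ t < h' (N - 1) ∧ ∀ j : ℕ,
      ((N : ℝ) - 1) * b < 1 / h j ^ 2 - 1 / h' j ^ 2 ∧ 1 / h j ^ 2 - 1 / h' j ^ 2 ≤ (N : ℝ) * (B (fun _ => γ) + M * γ) := by
  have hγ : 0 < γ := ht.trans_le (htt'.le.trans ht'γ)
  have huniq : ∀ p, 0 < p → p ≤ γ → ∀ u u' : ℕ → ℝ, SeqBox γ u → SeqBox γ u' → MemFlow B p u → MemFlow B p u' → u = u' :=
    fun _ hp0 hpγ _ _ hu hu' hfu hfu' => memFlow_unique_zs_closed hB hM hp0 hpγ hb hlo hsmall hu hu' hfu hfu'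
  obtain ⟨N, hN1, hN, hN'⟩ := exists_lag hb hlo ht htt' ht'γ hh' hf'
  exact ⟨N, hN1, hN, hN', fun j => disc_bounds_of_lag hb hB hM hlo (le_upper_of_zm hB hγ) huniq ht (htt'.le.trans ht'γ)
    hh hh' hf hf' hN1 hN hN' j⟩

end Summit.QuantumFields.BalabanUV.Beta.EriceRemainderEnclosureHistoryAutonomyOrderLag

end
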